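import Mathlib
import Literature.Computation.Certificates.SemidefiniteComplementarity
import HarnessLib

/-!
# Facial reduction for semidefinite programs: exposed faces of `S^n_+`, reduction certificates, the Borwein–Wolkowicz theorem of the alternative, and the Sieve-SDP basic step

Topic `Literature/Computation/Certificates`. The facial-reduction (FR) preprocessing of a semidefinite
program in primal standard form `(SDP-P)  ⟨A_i, X⟩ = b_i (i ∈ ι), X ⪰ 0` over `ℝ`, on top of
`SemidefiniteComplementarity` (`frob M X = Tr(M X)`, `IsPrimalFeasible A b X`, and Lemma 2.12 / Cor. A.24 of
[BlekhermanParriloThomas2012]: for `X, Z ⪰ 0`, `Tr(XZ) = 0 ↔ XZ = 0`). Facial reduction goes back to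
Borwein–Wolkowicz [BorweinWolkowicz1981]; statements and proofs below follow the survey of Drusvyatskiy and
Wolkowicz [DrusvyatskiyWolkowicz2017, §2.2, §3.1, §4.2–4.3] specialised to the cone `K = S^n_+`, with
Pataki's formulation of one FR step [Pataki2013, §3 Lemma 1] and the Sieve-SDP special case
[ZhuPatakiTrandinh2019, §1]. What a certificate checker needs is in §§1–3 and §5 (pure matrix algebra);
§4 is the existence theorem that makes FR a complete remedy for the failure of Slater's condition.

* §1 **Faces of `S^n_+` exposed by `W ⪰ 0`**: `face W = W^⊥ ∩ S^n_+ = {X ⪰ 0 : ⟨W, X⟩ = 0}`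
  [DrusvyatskiyWolkowicz2017, §2.2 Def. (Faces), Def. (Exposed faces)]; it is a face
  (`mem_face_of_add_mem`) and a convex cone (`add_mem_face`, `smul_mem_face`);
  `face_inter_face : face W₁ ∩ face W₂ = face (W₁ + W₂)` [§2.2 Prop. (Exposing the intersection of exposed
  faces)]; and the three descriptions of [§2.2 Example (Faces of `S^n_+`)]:
  `mem_face_iff_mul_eq_zero (W X = 0)`, `mem_face_iff_range_le_ker (range X ⊆ ker W)`,
  `mem_face_iff_exists_conj (X = V Z Vᵀ, Z ⪰ 0, for V spanning ker W)` — the last with the explicit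
  `Z = L X Lᵀ` for a left inverse `L` of `V`, and with "the columns of `V` span `ker W`" supplied as the two
  checkable facts `W V = 0` and `ker W ⊆ range V` (`ker_le_range_of_identity`: any identity
  `V L' + G W = 1` certifies the latter).
* §2 **FR certificates**: `expose A y = A^* y = Σ y_i A_i`; `IsCertificate A b y :↔ A^* y ⪰ 0 ∧ ⟨b, y⟩ = 0`
  (the feasible-case auxiliary system of [DrusvyatskiyWolkowicz2017, §3.1] without `A^* y ≠ 0`; Pataki's
  `y ∈ F^* ∩ N((A,b)^*)`
  at `F = K`). Soundness of one FR step `mem_face_expose`: every feasible `X` lies in `face (A^* y)`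
  [§3.1 Thm. (Theorem of the alternative for the primal), "Moreover"; Pataki2013 §3 Lemma 1 (1)], so
  `(A^* y) X = 0 = X (A^* y)`; the easy half of the alternative `expose_eq_zero_of_posDef` (a feasible
  `X ≻ 0` kills every certificate); and the infeasibility certificate `not_feasible_of_sum_neg`
  (`A^* y ⪰ 0`, `⟨b, y⟩ < 0`) [§3.1, the general auxiliary system `A^* y ⪰ 0, ⟨b,y⟩ ≤ 0` in its strict case].
* §3 **The reduced problem** [DrusvyatskiyWolkowicz2017, §4.3, the program `min ⟨VᵀCV, Z⟩ s.t. Â(Z) = b,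
  Z ⪰ 0` with `Â(Z) = A(VZVᵀ)`]: `compress V M = Vᵀ M V`, `frob_conj : ⟨M, VZVᵀ⟩ = ⟨VᵀMV, Z⟩`,
  `feasible_lift`, `feasible_descend` (every feasible `X` is `V Z Vᵀ` with `Z = L X Lᵀ` reduced-feasible) and
  `values_eq_values_compress`: original and reduced problem attain the same objective values ("the primal
  problem is equivalent to the smaller dimensional" one).
* §4 **Theorem of the alternative** [BorweinWolkowicz1981; DrusvyatskiyWolkowicz2017, §3.1 Thm. (Theorem of
  the alternative for the primal), via Thm. (Homogeneous separation)]: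
  `exists_certificate_of_not_strictlyFeasible` — if `(SDP-P)` with symmetric `A_i` is feasible but has no
  positive definite solution then a certificate with `A^* y ≠ 0` exists; packaged as
  `strictlyFeasible_iff_certificates_trivial`. The proof is the text's: separate the affine space
  `{X : A(X) = b}` from the open convex cone `quadPos = {X : vᵀXv > 0 ∀ v ≠ 0}` (`isOpen_quadPos` by
  compactness of the unit sphere, `convex_quadPos`) with `geometric_hahn_banach_open`, show the functional
  vanishes on `Null(A)` so that it is `⟨A^* c, ·⟩` (`mem_span_of_iInf_ker_le_ker`), and read off the signs.
* §5 **Sieve-SDP** [ZhuPatakiTrandinh2019, §1, Basic Step (Fig. 1)]: a single constraint with `A_{i₀} ⪰ 0`,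
  `b_{i₀} = 0` is the certificate `y = e_{i₀}` (`isCertificate_single`, `sieve_mul_eq_zero`); with
  `b_{i₀} < 0` it certifies infeasibility (`sieve_infeasible`); and if `A_{i₀} = [D 0; 0 0]` up to permutation
  with `D ≻ 0` indexed by `S` (stated index-wise: columns outside `S` vanish, and `uᵀA_{i₀}u > 0` for nonzero
  `u` supported in `S`) then every feasible `X` has zero rows and columns on `S` (`sieve_basic_step`;
  `posSemidef_of_block_posDef`, `apply_eq_zero_of_mulVec_eq_zero`).
* §6 **Worked example**: the motivating instance (1.1) of [ZhuPatakiTrandinh2019, §1] (`A₀ = e₁e₁ᵀ`, `b₀ = 0`;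
  `A₁` the anti-diagonal, `b₁ = -1`) is infeasible — `sieveEx_infeasible`, obtained from `sieve_basic_step`
  exactly as in the text (first row/column vanish, then `x₂₂ = -1 < 0`).

Conventions and scope. Real symmetric matrices only (`Matrix n n ℝ`, `Matrix.PosSemidef`, `ᵀ`); the
constraint family is indexed by a `Fintype ι`; "`V` spans `ker W`" is always given by the pair of hypotheses
`W * V = 0`, `∀ v, W v = 0 → v ∈ range V` plus a left inverse `L * V = 1` rather than by `Submodule`s, so that
all data of an FR step (`y`, `V`, `L`, and `L', G` with `V L' + G W = 1`) are finite matrices a checker can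
verify by ring arithmetic. Not formalised: general cones `K` and the conjugate-face calculus, the dual-side
statements (Thm. "for the dual"), minimal faces / the singularity degree and the Hölder error bounds of §4.4–4.5,
and the termination / minimality analysis of the FR iteration [Pataki2013, §3 Lemma 1 (2), Thm. 1].

References. [BorweinWolkowicz1981] J. M. Borwein, H. Wolkowicz, *Facial reduction for a cone-convex programming
problem*, J. Austral. Math. Soc. Ser. A 30 (1981) 369–380 (origin of FR; theorem numbers of that paper are not
quoted here). [DrusvyatskiyWolkowicz2017] D. Drusvyatskiy, H. Wolkowicz, *The many faces of degeneracy in conic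
optimization*, Found. Trends Optim. 3 (2017) 77–170, arXiv:1706.03705 — statements are cited by section and NAME
(§2.2 "Faces", "Exposed faces", "Exposing the intersection of exposed faces", "Faces of `S^n_+`"; §3.1
"Homogeneous separation", "Theorem of the alternative for the primal" with its two auxiliary systems; §4.3 the
reduced SDP), since the statement counters differ between the journal and arXiv versions. [Pataki2013] G. Pataki,
*Strong duality in conic linear programming: facial reduction and extended duals*, in: Computational and
Analytical Mathematics, Springer Proc. Math. Stat. 50 (2013) 613–634, arXiv:1301.7717, §3 Lemma 1.
[ZhuPatakiTrandinh2019] Y. Zhu, G. Pataki, Q. Tran-Dinh, *Sieve-SDP: a simple facial reduction algorithm to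
preprocess semidefinite programs*, Math. Program. Comput. 11 (2019) 503–586, §1 (Basic Step, Fig. 1; example
(1.1)). [KolmogorovNaldiZapata2025] V. Kolmogorov, S. Naldi, J. Zapata, *Certifying solutions of degenerate
semidefinite programs*, SIAM J. Optim. 35 (2025) 1630–1654, §3 (3.2)–(3.4) (the description
`F = {X ⪰ 0 : X = V Z Vᵀ}` of a face used in exact certification). [BlekhermanParriloThomas2012] App. A
Cor. A.24 / Ch. 2 Lemma 2.12 (via `SemidefiniteComplementarity.trace_mul_eq_zero_iff`).
-/

noncomputable section

open Matrix
open scoped BigOperators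

namespace Literature.Computation.Certificates.FacialReduction

open SemidefiniteComplementarity (frob IsPrimalFeasible frob_sum_smul_left frob_nonneg_of_posSemidef
  trace_mul_eq_zero_iff mul_eq_zero_comm)

variable {n : Type*} [Fintype n] [DecidableEq n] {ι : Type*} [Fintype ι]

/-! ## §1. Faces of `S^n_+` exposed by a positive semidefinite matrix -/

/-- The face of the positive semidefinite cone exposed by `W`: `W^⊥ ∩ S^n_+ = {X ⪰ 0 : ⟨W, X⟩ = 0}`
(the trace pairing `⟨W, X⟩ = Tr(W X)` is `frob`). [cite: DrusvyatskiyWolkowicz2017, §2.2 Def. (Exposed faces)] -/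
def face (W : Matrix n n ℝ) : Set (Matrix n n ℝ) := {X | X.PosSemidef ∧ frob W X = 0}

omit [DecidableEq n] in
/-- Unfolding of `face`. [cite: DrusvyatskiyWolkowicz2017, §2.2 Def. (Exposed faces)] -/
theorem mem_face_iff {W X : Matrix n n ℝ} : X ∈ face W ↔ X.PosSemidef ∧ frob W X = 0 := Iff.rfl

omit [DecidableEq n] in
/-- Additivity of the trace pairing in the second argument. [folklore] -/
private theorem frob_add_right (W X Y : Matrix n n ℝ) : frob W (X + Y) = frob W X + frob W Y := by
  simp [SemidefiniteComplementarity.frob, Matrix.mul_add, trace_add]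

omit [DecidableEq n] in
/-- Additivity of the trace pairing in the first argument. [folklore] -/
private theorem frob_add_left (W₁ W₂ X : Matrix n n ℝ) : frob (W₁ + W₂) X = frob W₁ X + frob W₂ X := by
  simp [SemidefiniteComplementarity.frob, Matrix.add_mul, trace_add]

omit [DecidableEq n] in
/-- Homogeneity of the trace pairing in the second argument. [folklore] -/
private theorem frob_smul_right (W X : Matrix n n ℝ) (c : ℝ) : frob W (c • X) = c * frob W X := by
  simp [SemidefiniteComplementarity.frob, Matrix.mul_smul, trace_smul]

/-- `W^⊥ ∩ S^n_+` is a face of `S^n_+` in the sense of Def. (Faces): `X, Y ⪰ 0`, `X + Y ∈ F ⟹ X, Y ∈ F`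
("for any vector `v ∈ K^*` one can readily verify that the set `F = v^⊥ ∩ K` is a face of `K`").
[cite: DrusvyatskiyWolkowicz2017, §2.2 Def. (Faces) and the remark before Def. (Exposed faces)] -/
theorem mem_face_of_add_mem {W X Y : Matrix n n ℝ} (hW : W.PosSemidef) (hX : X.PosSemidef)
    (hY : Y.PosSemidef) (h : X + Y ∈ face W) : X ∈ face W ∧ Y ∈ face W := by
  have hX0 := frob_nonneg_of_posSemidef hW hX
  have hY0 := frob_nonneg_of_posSemidef hW hY
  have hsum : frob W X + frob W Y = 0 := by rw [← frob_add_right]; exact h.2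
  exact ⟨⟨hX, by linarith⟩, ⟨hY, by linarith⟩⟩

omit [DecidableEq n] in
/-- The exposed face is a convex cone: closed under addition … [cite: DrusvyatskiyWolkowicz2017, §2.2 Def. (Faces)] -/
theorem add_mem_face {W X Y : Matrix n n ℝ} (hX : X ∈ face W) (hY : Y ∈ face W) : X + Y ∈ face W :=
  ⟨hX.1.add hY.1, by rw [frob_add_right, hX.2, hY.2, add_zero]⟩

omit [DecidableEq n] in
/-- … and under nonnegative scaling. [cite: DrusvyatskiyWolkowicz2017, §2.2 Def. (Faces)] -/
theorem smul_mem_face {W X : Matrix n n ℝ} {c : ℝ} (hc : 0 ≤ c) (hX : X ∈ face W) : c • X ∈ face W :=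
  ⟨hX.1.smul hc, by rw [frob_smul_right, hX.2, mul_zero]⟩

/-- **Proposition (Exposing the intersection of exposed faces)**: for `W₁, W₂ ⪰ 0`,
`(W₁^⊥ ∩ S^n_+) ∩ (W₂^⊥ ∩ S^n_+) = (W₁ + W₂)^⊥ ∩ S^n_+` — exposing vectors of successive facial-reduction
steps may be summed. [cite: DrusvyatskiyWolkowicz2017, §2.2 Prop. (Exposing the intersection of exposed faces)] -/
theorem face_inter_face {W₁ W₂ : Matrix n n ℝ} (h₁ : W₁.PosSemidef) (h₂ : W₂.PosSemidef) :
    face W₁ ∩ face W₂ = face (W₁ + W₂) := by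
  ext X
  constructor
  · rintro ⟨⟨hX, e₁⟩, ⟨-, e₂⟩⟩
    exact ⟨hX, by rw [frob_add_left, e₁, e₂, add_zero]⟩
  · rintro ⟨hX, e⟩
    have a := frob_nonneg_of_posSemidef h₁ hX
    have b := frob_nonneg_of_posSemidef h₂ hX
    rw [frob_add_left] at e
    exact ⟨⟨hX, by linarith⟩, ⟨hX, by linarith⟩⟩

/-- `X ∈ W^⊥ ∩ S^n_+` iff `X ⪰ 0` and `W X = 0` (for `W ⪰ 0`): the trace pairing of two positive
semidefinite matrices vanishes iff their product does. [cite: DrusvyatskiyWolkowicz2017, §2.2 Example (Faces of S^n_+)]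
[cite: BlekhermanParriloThomas2012, App. A Cor. A.24] -/
theorem mem_face_iff_mul_eq_zero {W X : Matrix n n ℝ} (hW : W.PosSemidef) :
    X ∈ face W ↔ X.PosSemidef ∧ W * X = 0 := by
  constructor
  · rintro ⟨hX, h⟩
    exact ⟨hX, (trace_mul_eq_zero_iff hW hX).mp h⟩
  · rintro ⟨hX, h⟩
    exact ⟨hX, (trace_mul_eq_zero_iff hW hX).mpr h⟩

/-- Same with the product in the other order: `X ∈ W^⊥ ∩ S^n_+` iff `X ⪰ 0` and `X W = 0`.
[cite: DrusvyatskiyWolkowicz2017, §2.2 Example (Faces of S^n_+)] [cite: BlekhermanParriloThomas2012, App. A Cor. A.24] -/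
theorem mem_face_iff_mul_eq_zero' {W X : Matrix n n ℝ} (hW : W.PosSemidef) :
    X ∈ face W ↔ X.PosSemidef ∧ X * W = 0 := by
  rw [mem_face_iff_mul_eq_zero hW]
  constructor
  · rintro ⟨hX, h⟩
    exact ⟨hX, (mul_eq_zero_comm hW hX).mp h⟩
  · rintro ⟨hX, h⟩
    exact ⟨hX, (mul_eq_zero_comm hW hX).mpr h⟩

omit [DecidableEq n] in
/-- `(M e_j)_i = M_{ij}`. [folklore] -/
private theorem mulVec_single_one_apply (M : Matrix n n ℝ) [DecidableEq n] (i j : n) :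
    (M *ᵥ Pi.single j 1) i = M i j := by
  simp [Matrix.mulVec, dotProduct_single]

/-- **Example (Faces of `S^n_+`), range form**: `X ∈ W^⊥ ∩ S^n_+` iff `X ⪰ 0` and
`range X ⊆ ker W` (`= 𝓡`, the subspace indexing the face `F_𝓡 = {X ⪰ 0 : range X ⊆ 𝓡}`).
[cite: DrusvyatskiyWolkowicz2017, §2.2 Example (Faces of S^n_+)] -/
theorem mem_face_iff_range_le_ker {W X : Matrix n n ℝ} (hW : W.PosSemidef) :
    X ∈ face W ↔ X.PosSemidef ∧ ∀ v : n → ℝ, W *ᵥ (X *ᵥ v) = 0 := by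
  rw [mem_face_iff_mul_eq_zero hW]
  refine and_congr_right fun _ => ⟨fun h v => by rw [mulVec_mulVec, h, zero_mulVec], fun h => ?_⟩
  ext i j
  have hij := congrFun (h (Pi.single j 1)) i
  rwa [mulVec_mulVec, mulVec_single_one_apply] at hij

/-- A checkable certificate that the columns of `V` span `ker W`: matrices `L', G` with
`V L' + G W = 1` give `ker W ⊆ range V` (then `v = V (L' v)` for `W v = 0`) — the certificate form of the
hypothesis "`range V = 𝓡 (= ker W)`" of the parametrisation `F_𝓡 = V S^r_+ Vᵀ`.
[cite: DrusvyatskiyWolkowicz2017, §2.2 Example (Faces of S^n_+), hypothesis `range V = 𝓡`] -/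
theorem ker_le_range_of_identity {r : Type*} [Fintype r] {W : Matrix n n ℝ} {V : Matrix n r ℝ}
    {L' : Matrix r n ℝ} {G : Matrix n n ℝ} (h : V * L' + G * W = 1) (v : n → ℝ) (hv : W *ᵥ v = 0) :
    ∃ w : r → ℝ, V *ᵥ w = v := by
  refine ⟨L' *ᵥ v, ?_⟩
  have := congrArg (fun M : Matrix n n ℝ => M *ᵥ v) h
  simp only [add_mulVec, ← mulVec_mulVec, hv, mulVec_zero, add_zero, one_mulVec] at this
  exact this

/-- Columns of `X` lying in `ker W ⊆ range V` factor `X = V M`. [cite: DrusvyatskiyWolkowicz2017, §2.2 Example (Faces of S^n_+)] -/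
theorem exists_eq_mul_of_range_le {r : Type*} [Fintype r] (V : Matrix n r ℝ) {W X : Matrix n n ℝ}
    (hker : ∀ v : n → ℝ, W *ᵥ v = 0 → ∃ w : r → ℝ, V *ᵥ w = v)
    (hWX : ∀ v : n → ℝ, W *ᵥ (X *ᵥ v) = 0) : ∃ M : Matrix r n ℝ, X = V * M := by
  choose w hw using fun k => hker (X *ᵥ Pi.single k 1) (hWX _)
  refine ⟨fun i k => w k i, ?_⟩
  ext j k
  have hjk := congrFun (hw k) j
  rw [mulVec_single_one_apply] at hjk
  rw [← hjk]
  simp [Matrix.mul_apply, Matrix.mulVec, dotProduct]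

/-- **Example (Faces of `S^n_+`), parametrised form "`F_𝓡 = V S^r_+ Vᵀ` for any `V` with
`range V = 𝓡`"**: if the columns of `V` span `ker W` (`W V = 0`, `ker W ⊆ range V`) and `L` is a left
inverse of `V`, then `W^⊥ ∩ S^n_+ = {V Z Vᵀ : Z ⪰ 0}`; explicitly `Z = L X Lᵀ`.
[cite: DrusvyatskiyWolkowicz2017, §2.2 Example (Faces of S^n_+)] [cite: KolmogorovNaldiZapata2025, §3 eq. (3.2)] -/
theorem mem_face_iff_exists_conj {r : Type*} [Fintype r] [DecidableEq r] {W X : Matrix n n ℝ}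
    (hW : W.PosSemidef) (V : Matrix n r ℝ) (L : Matrix r n ℝ) (hLV : L * V = 1) (hWV : W * V = 0)
    (hker : ∀ v : n → ℝ, W *ᵥ v = 0 → ∃ w : r → ℝ, V *ᵥ w = v) :
    X ∈ face W ↔ ∃ Z : Matrix r r ℝ, Z.PosSemidef ∧ X = V * Z * Vᵀ := by
  constructor
  · intro hX
    obtain ⟨hXp, hWX⟩ := (mem_face_iff_range_le_ker hW).mp hX
    obtain ⟨M, hM⟩ := exists_eq_mul_of_range_le V hker hWX
    have h1 : V * (L * X) = X := by
      rw [hM, ← Matrix.mul_assoc, ← Matrix.mul_assoc, Matrix.mul_assoc V L V, hLV, Matrix.mul_one]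
    have hXt : Xᵀ = X := by simpa using hXp.isHermitian.eq
    have h2 : X * (Lᵀ * Vᵀ) = X := by
      have := congrArg Matrix.transpose h1
      rw [transpose_mul, transpose_mul, hXt] at this
      rw [← Matrix.mul_assoc]
      exact this
    refine ⟨L * X * Lᵀ, ?_, ?_⟩
    · simpa using hXp.mul_mul_conjTranspose_same L
    · calc X = V * (L * X) := h1.symm
        _ = V * (L * (X * (Lᵀ * Vᵀ))) := by rw [h2]
        _ = V * (L * X * Lᵀ) * Vᵀ := by simp only [Matrix.mul_assoc]
  · rintro ⟨Z, hZ, rfl⟩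
    refine (mem_face_iff_mul_eq_zero hW).mpr ⟨?_, ?_⟩
    · simpa using hZ.mul_mul_conjTranspose_same V
    · rw [← Matrix.mul_assoc, ← Matrix.mul_assoc, hWV, Matrix.zero_mul, Matrix.zero_mul]

/-! ## §2. Facial-reduction certificates for (SDP-P) `{X ⪰ 0 : ⟨A_i, X⟩ = b_i}` -/

/-- The exposing matrix `A^* y = ∑ y_i A_i` of a multiplier vector `y`.
[cite: DrusvyatskiyWolkowicz2017, §3.1 Thm. (Theorem of the alternative for the primal), auxiliary system of the feasible case] -/
def expose (A : ι → Matrix n n ℝ) (y : ι → ℝ) : Matrix n n ℝ := ∑ i, y i • A i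

/-- A **facial-reduction certificate** for the feasible system `A(X) = b, X ⪰ 0`: `y` with
`A^* y ⪰ 0` and `⟨b, y⟩ = 0` (the auxiliary system of the feasible case without the side condition `A^* y ≠ 0`;
Pataki's `y ∈ F^* ∩ L`, `L = N((A,b)^*)`, at `F = K = S^n_+`).
[cite: DrusvyatskiyWolkowicz2017, §3.1 Thm. (Theorem of the alternative for the primal), auxiliary system of the feasible case] [cite: Pataki2013, §3 Lemma 1 (1)]
[cite: BorweinWolkowicz1981, §3 (origin)] -/
def IsCertificate (A : ι → Matrix n n ℝ) (b : ι → ℝ) (y : ι → ℝ) : Prop :=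
  (expose A y).PosSemidef ∧ ∑ i, y i * b i = 0

/-- `⟨A^* y, X⟩ = ∑ y_i ⟨A_i, X⟩`. [cite: DrusvyatskiyWolkowicz2017, §3.1, proof of Thm. (Theorem of the alternative for the primal)] -/
theorem frob_expose (A : ι → Matrix n n ℝ) (y : ι → ℝ) (X : Matrix n n ℝ) :
    frob (expose A y) X = ∑ i, y i * frob (A i) X :=
  frob_sum_smul_left y A X

/-- On a feasible point `⟨A^* y, X⟩ = ⟨y, A(X)⟩ = ⟨b, y⟩` ("`0 ≤ ⟨x, A^*y⟩ = ⟨b, y⟩`").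
[cite: DrusvyatskiyWolkowicz2017, §3.1, proof of Thm. (Theorem of the alternative for the primal)] -/
theorem frob_expose_of_feasible {A : ι → Matrix n n ℝ} {b : ι → ℝ} {X : Matrix n n ℝ}
    (hX : IsPrimalFeasible A b X) (y : ι → ℝ) : frob (expose A y) X = ∑ i, y i * b i := by
  rw [frob_expose]
  exact Finset.sum_congr rfl fun i _ => by rw [hX.2 i]

/-- **Facial reduction, soundness of one step** (Borwein–Wolkowicz; "any vector `y` satisfying [the auxiliary system]
yields a proper face `(A^*y)^⊥ ∩ K` containing the primal feasible region `𝓕_p`"; Pataki's Lemma 1 (1)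
`F_min ⊆ F ∩ y^⊥`): every feasible `X` lies in the face of `S^n_+` exposed by `A^* y`.
[cite: DrusvyatskiyWolkowicz2017, §3.1 Thm. (Theorem of the alternative for the primal), "Moreover" clause] [cite: Pataki2013, §3 Lemma 1 (1)]
[cite: BorweinWolkowicz1981, §3] -/
theorem mem_face_expose {A : ι → Matrix n n ℝ} {b : ι → ℝ} {y : ι → ℝ} {X : Matrix n n ℝ}
    (hy : IsCertificate A b y) (hX : IsPrimalFeasible A b X) : X ∈ face (expose A y) :=
  ⟨hX.1, by rw [frob_expose_of_feasible hX, hy.2]⟩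

/-- Hence `(A^* y) X = 0` for every feasible `X` … [cite: DrusvyatskiyWolkowicz2017, §3.1 Thm. (Theorem of the alternative for the primal); §4.3] -/
theorem expose_mul_eq_zero {A : ι → Matrix n n ℝ} {b : ι → ℝ} {y : ι → ℝ} {X : Matrix n n ℝ}
    (hy : IsCertificate A b y) (hX : IsPrimalFeasible A b X) : expose A y * X = 0 :=
  ((mem_face_iff_mul_eq_zero hy.1).mp (mem_face_expose hy hX)).2

/-- … and `X (A^* y) = 0`. [cite: DrusvyatskiyWolkowicz2017, §3.1 Thm. (Theorem of the alternative for the primal); §4.3] -/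
theorem mul_expose_eq_zero {A : ι → Matrix n n ℝ} {b : ι → ℝ} {y : ι → ℝ} {X : Matrix n n ℝ}
    (hy : IsCertificate A b y) (hX : IsPrimalFeasible A b X) : X * expose A y = 0 :=
  ((mem_face_iff_mul_eq_zero' hy.1).mp (mem_face_expose hy hX)).2

/-- **Theorem of the alternative, easy half**: a strictly feasible point (feasible `X ≻ 0`) forces every
facial-reduction certificate to be trivial, `A^* y = 0`; contrapositively a certificate with `A^* y ≠ 0`
refutes Slater's condition. [cite: DrusvyatskiyWolkowicz2017, §3.1 Thm. (Theorem of the alternative for the primal) (the alternatives exclude each other)]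
[cite: Pataki2013, §3 Lemma 1] -/
theorem expose_eq_zero_of_posDef {A : ι → Matrix n n ℝ} {b : ι → ℝ} {y : ι → ℝ} {X : Matrix n n ℝ}
    (hy : IsCertificate A b y) (hX : IsPrimalFeasible A b X) (hXd : X.PosDef) : expose A y = 0 := by
  have h := expose_mul_eq_zero hy hX
  have hU : IsUnit X.det := (isUnit_iff_isUnit_det X).mp hXd.isUnit
  calc expose A y = expose A y * X * X⁻¹ := by rw [Matrix.mul_assoc, mul_nonsing_inv X hU, Matrix.mul_one]
    _ = 0 := by rw [h, Matrix.zero_mul]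

/-- **Infeasibility certificate** (the first auxiliary system of the theorem of the alternative with `⟨b, y⟩ < 0`; Sieve-SDP's
"if `b_i < 0` declare (P) infeasible"): `A^* y ⪰ 0` and `⟨b, y⟩ < 0` exclude every feasible point, since a
feasible `X ⪰ 0` would give `0 ≤ ⟨A^* y, X⟩ = ⟨b, y⟩ < 0`. [cite: DrusvyatskiyWolkowicz2017, §3.1 Thm. (Theorem of the alternative for the primal), first auxiliary system]
[cite: ZhuPatakiTrandinh2019, §1 Basic Step (Fig. 1)] -/
theorem not_feasible_of_sum_neg {A : ι → Matrix n n ℝ} {b : ι → ℝ} {y : ι → ℝ}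
    (hW : (expose A y).PosSemidef) (hb : ∑ i, y i * b i < 0) (X : Matrix n n ℝ) :
    ¬ IsPrimalFeasible A b X := fun hX =>
  not_lt.mpr (frob_nonneg_of_posSemidef hW hX.1) (by rw [frob_expose_of_feasible hX]; exact hb)

/-! ## §3. The reduced problem `Â(Z) = A(V Z Vᵀ)` on the face `V S^r_+ Vᵀ` -/

/-- Compression of a constraint / cost matrix to the face `V S^r_+ Vᵀ`: `Vᵀ M V`, so that
`⟨M, V Z Vᵀ⟩ = ⟨Vᵀ M V, Z⟩` (`Â(Z) = A(VZVᵀ)`, cost `⟨VᵀCV, Z⟩`). [cite: DrusvyatskiyWolkowicz2017, §4.3 (the reduced problem)] -/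
def compress {r : Type*} (V : Matrix n r ℝ) (M : Matrix n n ℝ) : Matrix r r ℝ := Vᵀ * M * V

omit [DecidableEq n] in
/-- `⟨M, V Z Vᵀ⟩ = ⟨Vᵀ M V, Z⟩` (cyclicity of the trace). [cite: DrusvyatskiyWolkowicz2017, §4.3 (the reduced problem)] -/
theorem frob_conj {r : Type*} [Fintype r] (M : Matrix n n ℝ) (V : Matrix n r ℝ) (Z : Matrix r r ℝ) :
    frob M (V * Z * Vᵀ) = frob (compress V M) Z := by
  unfold SemidefiniteComplementarity.frob compress
  calc (M * (V * Z * Vᵀ)).trace = ((M * (V * Z)) * Vᵀ).trace := by simp only [Matrix.mul_assoc]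
    _ = (Vᵀ * (M * (V * Z))).trace := trace_mul_comm _ _
    _ = (Vᵀ * M * V * Z).trace := by simp only [Matrix.mul_assoc]

omit [DecidableEq n] [Fintype ι] in
/-- **Lift**: a feasible point `Z` of the reduced problem `{Z ⪰ 0 : ⟨Vᵀ A_i V, Z⟩ = b_i}` gives the feasible
point `V Z Vᵀ` of the original one, with the same cost `⟨C, VZVᵀ⟩ = ⟨VᵀCV, Z⟩` (`frob_conj`).
[cite: DrusvyatskiyWolkowicz2017, §4.3 (the reduced problem)] -/
theorem feasible_lift {r : Type*} [Fintype r] {A : ι → Matrix n n ℝ} {b : ι → ℝ} (V : Matrix n r ℝ)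
    {Z : Matrix r r ℝ} (hZ : IsPrimalFeasible (fun i => compress V (A i)) b Z) :
    IsPrimalFeasible A b (V * Z * Vᵀ) :=
  ⟨by simpa using hZ.1.mul_mul_conjTranspose_same V, fun i => by rw [frob_conj]; exact hZ.2 i⟩

/-- **Descend** ("the primal problem is equivalent to the smaller dimensional" reduced one): given a
facial-reduction certificate `y` and `V` spanning `ker (A^* y)` with left inverse `L`, every feasible `X`
equals `V Z Vᵀ` for the reduced-feasible `Z = L X Lᵀ`. [cite: DrusvyatskiyWolkowicz2017, §4.2–4.3 (the reduced problem)]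
[cite: Pataki2013, §1 ("the feasible set of (P) remains the same if we replace its constraint set by `Ax ≤_{F_min} b`")] -/
theorem feasible_descend {r : Type*} [Fintype r] [DecidableEq r] {A : ι → Matrix n n ℝ} {b : ι → ℝ}
    {y : ι → ℝ} (hy : IsCertificate A b y) (V : Matrix n r ℝ) (L : Matrix r n ℝ) (hLV : L * V = 1)
    (hWV : expose A y * V = 0) (hker : ∀ v : n → ℝ, expose A y *ᵥ v = 0 → ∃ w : r → ℝ, V *ᵥ w = v)
    {X : Matrix n n ℝ} (hX : IsPrimalFeasible A b X) :
    IsPrimalFeasible (fun i => compress V (A i)) b (L * X * Lᵀ) ∧ X = V * (L * X * Lᵀ) * Vᵀ := by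
  obtain ⟨Z, hZ, hXZ⟩ := (mem_face_iff_exists_conj hy.1 V L hLV hWV hker).mp (mem_face_expose hy hX)
  have hVL : Vᵀ * Lᵀ = 1 := by rw [← transpose_mul, hLV, transpose_one]
  have hZeq : L * X * Lᵀ = Z := by
    rw [hXZ]
    calc L * (V * Z * Vᵀ) * Lᵀ = (L * V) * Z * (Vᵀ * Lᵀ) := by simp only [Matrix.mul_assoc]
      _ = Z := by rw [hLV, hVL, Matrix.one_mul, Matrix.mul_one]
  rw [hZeq]
  exact ⟨⟨hZ, fun i => by rw [← frob_conj, ← hXZ]; exact hX.2 i⟩, hXZ⟩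

/-- **Equivalence of the original and the reduced problem**: under a facial-reduction certificate the two
problems have the same set of attained objective values (hence the same optimal value and the same
feasibility status), `{⟨C, X⟩ : X feasible} = {⟨VᵀCV, Z⟩ : Z reduced-feasible}`.
[cite: DrusvyatskiyWolkowicz2017, §4.2–4.3 (the reduced problem)] [cite: BorweinWolkowicz1981, §3] -/
theorem values_eq_values_compress {r : Type*} [Fintype r] [DecidableEq r] {A : ι → Matrix n n ℝ}
    {b : ι → ℝ} {y : ι → ℝ} (hy : IsCertificate A b y) (V : Matrix n r ℝ) (L : Matrix r n ℝ)
    (hLV : L * V = 1) (hWV : expose A y * V = 0)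
    (hker : ∀ v : n → ℝ, expose A y *ᵥ v = 0 → ∃ w : r → ℝ, V *ᵥ w = v) (C : Matrix n n ℝ) :
    {t : ℝ | ∃ X, IsPrimalFeasible A b X ∧ frob C X = t} =
      {t : ℝ | ∃ Z, IsPrimalFeasible (fun i => compress V (A i)) b Z ∧ frob (compress V C) Z = t} := by
  ext t
  constructor
  · rintro ⟨X, hX, rfl⟩
    obtain ⟨hZ, hXZ⟩ := feasible_descend hy V L hLV hWV hker hX
    exact ⟨L * X * Lᵀ, hZ, by rw [← frob_conj, ← hXZ]⟩
  · rintro ⟨Z, hZ, rfl⟩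
    exact ⟨V * Z * Vᵀ, feasible_lift V hZ, frob_conj C V Z⟩

/-! ## §4. The theorem of the alternative for strict feasibility (Borwein–Wolkowicz 1981; DW §3.1) -/

section Alternative

open Filter Topology

/-- The trace pairing with a fixed matrix as a linear functional `X ↦ ⟨M, X⟩ = tr(MX)`.
[cite: DrusvyatskiyWolkowicz2017, §2.1 (trace inner product)] -/
def frobLin (M : Matrix n n ℝ) : Matrix n n ℝ →ₗ[ℝ] ℝ where
  toFun X := frob M X
  map_add' X Y := frob_add_right M X Y
  map_smul' c X := by rw [frob_smul_right]; rfl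

omit [DecidableEq n] in
/-- `frobLin M X = ⟨M, X⟩`. [folklore] -/
@[simp] private theorem frobLin_apply (M X : Matrix n n ℝ) : frobLin M X = frob M X := rfl

/-- "Quadratically positive" matrices `{X : vᵀXv > 0 for all v ≠ 0}` (not required to be symmetric; the
symmetric ones are exactly the positive definite matrices) — an OPEN convex cone of `Matrix n n ℝ` playing
the part of `int K` in the homogeneous separation theorem (a device of this file's proof of the theorem of the
alternative). [folklore] -/
private def quadPos (n : Type*) [Fintype n] : Set (Matrix n n ℝ) := {X | ∀ v : n → ℝ, v ≠ 0 → 0 < v ⬝ᵥ (X *ᵥ v)}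

omit [DecidableEq n] in
/-- `vᵀv > 0` for `v ≠ 0`. [folklore] -/
private theorem dotProduct_self_pos' {v : n → ℝ} (hv : v ≠ 0) : 0 < v ⬝ᵥ v :=
  lt_of_le_of_ne (Finset.sum_nonneg fun i _ => mul_self_nonneg (v i))
    (Ne.symm (mt dotProduct_self_eq_zero.mp hv))

omit [DecidableEq n] in
/-- `vᵀ(X+Y)v = vᵀXv + vᵀYv`. [folklore] -/
private theorem quad_add (X Y : Matrix n n ℝ) (v : n → ℝ) :
    v ⬝ᵥ ((X + Y) *ᵥ v) = v ⬝ᵥ (X *ᵥ v) + v ⬝ᵥ (Y *ᵥ v) := by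
  rw [add_mulVec, dotProduct_add]

omit [DecidableEq n] in
/-- `vᵀ(cX)v = c·vᵀXv`. [folklore] -/
private theorem quad_smul (c : ℝ) (X : Matrix n n ℝ) (v : n → ℝ) :
    v ⬝ᵥ ((c • X) *ᵥ v) = c * (v ⬝ᵥ (X *ᵥ v)) := by
  rw [smul_mulVec, dotProduct_smul, smul_eq_mul]

omit [DecidableEq n] in
/-- `quadPos` is convex. [folklore] -/
private theorem convex_quadPos : Convex ℝ (quadPos n) := by
  intro X hX Y hY a c ha hc hac v hv
  show 0 < v ⬝ᵥ ((a • X + c • Y) *ᵥ v)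
  rw [quad_add, quad_smul, quad_smul]
  have h1 := hX v hv
  have h2 := hY v hv
  rcases ha.eq_or_lt with h | ha'
  · rw [← h, zero_add] at hac
    rw [← h, hac, zero_mul, zero_add, one_mul]
    exact h2
  · exact add_pos_of_pos_of_nonneg (mul_pos ha' h1) (mul_nonneg hc h2.le)

omit [DecidableEq n] in
/-- `quadPos` is closed under positive scaling (a cone). [folklore] -/
private theorem smul_mem_quadPos {c : ℝ} (hc : 0 < c) {X : Matrix n n ℝ} (hX : X ∈ quadPos n) :
    c • X ∈ quadPos n := fun v hv => by
  rw [quad_smul]; exact mul_pos hc (hX v hv)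

/-- `X + ε·1 ∈ quadPos` for `X ⪰ 0`, `ε > 0` (positive semidefinite matrices lie in the closure of the open
cone). [folklore] -/
private theorem add_smul_one_mem_quadPos {X : Matrix n n ℝ} (hX : X.PosSemidef) {ε : ℝ} (hε : 0 < ε) :
    X + ε • (1 : Matrix n n ℝ) ∈ quadPos n := fun v hv => by
  rw [quad_add, quad_smul, one_mulVec]
  have h0 : 0 ≤ v ⬝ᵥ (X *ᵥ v) := by simpa using hX.dotProduct_mulVec_nonneg v
  exact add_pos_of_nonneg_of_pos h0 (mul_pos hε (dotProduct_self_pos' hv))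

/-- In particular `1 ∈ quadPos`. [folklore] -/
private theorem one_mem_quadPos : (1 : Matrix n n ℝ) ∈ quadPos n := by
  simpa using add_smul_one_mem_quadPos (PosSemidef.zero (n := n) (R := ℝ)) one_pos

omit [DecidableEq n] in
/-- Joint continuity of `(X, v) ↦ vᵀXv`. [folklore] -/
private theorem continuous_quad :
    Continuous fun p : Matrix n n ℝ × (n → ℝ) => p.2 ⬝ᵥ (p.1 *ᵥ p.2) :=
  Continuous.dotProduct continuous_snd (Continuous.matrix_mulVec continuous_fst continuous_snd)

omit [DecidableEq n] in
/-- `quadPos` is described by the compact unit sphere of the sup norm: `X ∈ quadPos` iff `vᵀXv > 0` for all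
`v` with `‖v‖ = 1`. [folklore] -/
private theorem mem_quadPos_iff_sphere {X : Matrix n n ℝ} :
    X ∈ quadPos n ↔ ∀ v ∈ Metric.sphere (0 : n → ℝ) 1, 0 < v ⬝ᵥ (X *ᵥ v) := by
  constructor
  · intro hX v hv
    refine hX v ?_
    intro h0
    rw [h0] at hv
    simp at hv
  · intro h v hv
    have hnv : 0 < ‖v‖ := norm_pos_iff.mpr hv
    have hu : ‖v‖⁻¹ • v ∈ Metric.sphere (0 : n → ℝ) 1 := by
      rw [mem_sphere_zero_iff_norm, norm_smul, norm_inv, norm_norm, inv_mul_cancel₀ hnv.ne']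
    have := h _ hu
    rw [mulVec_smul, dotProduct_smul, smul_dotProduct, smul_eq_mul, smul_eq_mul] at this
    have hq : 0 < ‖v‖⁻¹ * (‖v‖⁻¹ * (v ⬝ᵥ (X *ᵥ v))) := this
    by_contra hle
    have hle : v ⬝ᵥ (X *ᵥ v) ≤ 0 := not_lt.mp hle
    have : ‖v‖⁻¹ * (‖v‖⁻¹ * (v ⬝ᵥ (X *ᵥ v))) ≤ 0 :=
      mul_nonpos_of_nonneg_of_nonpos (inv_nonneg.mpr hnv.le)
        (mul_nonpos_of_nonneg_of_nonpos (inv_nonneg.mpr hnv.le) hle)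
    exact absurd hq (not_lt.mpr this)

omit [DecidableEq n] in
/-- `quadPos` is open (compactness of the unit sphere: the tube lemma). [folklore] -/
private theorem isOpen_quadPos : IsOpen (quadPos n) := by
  rw [isOpen_iff_eventually]
  intro X₀ hX₀
  have hK : IsCompact (Metric.sphere (0 : n → ℝ) 1) := isCompact_sphere 0 1
  have hP : ∀ v ∈ Metric.sphere (0 : n → ℝ) 1,
      ∀ᶠ z : Matrix n n ℝ × (n → ℝ) in 𝓝 (X₀, v), 0 < z.2 ⬝ᵥ (z.1 *ᵥ z.2) := by
    intro v hv
    have hpos : 0 < v ⬝ᵥ (X₀ *ᵥ v) := (mem_quadPos_iff_sphere.mp hX₀) v hv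
    exact (isOpen_lt continuous_const continuous_quad).mem_nhds hpos
  have hev := hK.eventually_forall_of_forall_eventually
    (P := fun (X : Matrix n n ℝ) (v : n → ℝ) => 0 < v ⬝ᵥ (X *ᵥ v)) hP
  exact hev.mono fun X hX => mem_quadPos_iff_sphere.mpr hX

omit [DecidableEq n] in
/-- `vᵀXᵀv = vᵀXv`. [folklore] -/
private theorem quad_transpose (X : Matrix n n ℝ) (v : n → ℝ) : v ⬝ᵥ (Xᵀ *ᵥ v) = v ⬝ᵥ (X *ᵥ v) := by
  rw [mulVec_transpose, dotProduct_comm, ← dotProduct_mulVec]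

omit [DecidableEq n] in
/-- `⟨M, Xᵀ⟩ = ⟨M, X⟩` for symmetric `M`. [folklore] -/
private theorem frob_transpose_right_of_isHermitian {M : Matrix n n ℝ} (hM : M.IsHermitian)
    (X : Matrix n n ℝ) : frob M Xᵀ = frob M X := by
  have hMt : Mᵀ = M := by simpa using hM.eq
  unfold SemidefiniteComplementarity.frob
  calc (M * Xᵀ).trace = (M * Xᵀ)ᵀ.trace := (trace_transpose _).symm
    _ = (X * Mᵀ).trace := by rw [transpose_mul, transpose_transpose]
    _ = (Mᵀ * X).trace := trace_mul_comm _ _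
    _ = (M * X).trace := by rw [hMt]

omit [DecidableEq n] in
/-- `vᵀ W v = ⟨W, v vᵀ⟩ = tr(W vvᵀ)` ("the trace inner product is itself the dot product between the two matrices
stretched into vectors"). [cite: DrusvyatskiyWolkowicz2017, §2.1 (trace inner product)] -/
theorem frob_vecMulVec (W : Matrix n n ℝ) (v : n → ℝ) : frob W (vecMulVec v v) = v ⬝ᵥ (W *ᵥ v) := by
  unfold SemidefiniteComplementarity.frob
  rw [mul_vecMulVec, trace_vecMulVec, dotProduct_comm]

omit [Fintype n] [DecidableEq n] in
/-- The exposing matrix `A^* y = Σ y_i A_i` of a multiplier vector is symmetric when the `A_i` are (`A^* : ℝ^m → S^n`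
for semidefinite programming). [cite: DrusvyatskiyWolkowicz2017, §2.1 (adjoint) and §2.3 (SDP: `K = S^n_+`, `F = ℝ^m`)] -/
theorem isHermitian_expose {A : ι → Matrix n n ℝ} (hA : ∀ i, (A i).IsHermitian) (y : ι → ℝ) :
    (expose A y).IsHermitian := by
  unfold expose Matrix.IsHermitian
  rw [conjTranspose_sum]
  exact Finset.sum_congr rfl fun i _ => by rw [conjTranspose_smul, (hA i).eq, star_trivial]

omit [Fintype n] [DecidableEq n] in
/-- `A^*(-y) = -A^* y`. [folklore] -/
private theorem expose_neg (A : ι → Matrix n n ℝ) (y : ι → ℝ) : expose A (-y) = -expose A y := by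
  simp [expose, neg_smul, Finset.sum_neg_distrib]

/-- **Theorem of the alternative for strict feasibility, hard half** (Borwein–Wolkowicz 1981; the Drusvyatskiy–Wolkowicz
"theorem of the alternative for the primal" for `K = S^n_+`): if the system `⟨A_i, X⟩ = b_i, X ⪰ 0` (symmetric `A_i`) is feasible
but has NO positive definite solution, then there is a multiplier vector `y` with `0 ≠ A^* y ⪰ 0` and
`⟨b, y⟩ = 0` — a nontrivial facial-reduction certificate ("if strict feasibility fails, there always exists
a 'witness' (or 'short certificate') `y` satisfying the auxiliary system").  Proof as in the text:
separate the affine space `{X : A(X) = b}` from the open cone by a linear functional (geometric Hahn–Banach),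
show the functional vanishes on `Null(A)` hence equals `⟨A^* y, ·⟩`, and read off the signs.
[cite: DrusvyatskiyWolkowicz2017, §3.1 Thm. (Homogeneous separation) and Thm. (Theorem of the alternative for the primal)] [cite: BorweinWolkowicz1981, §3]
[cite: Pataki2013, §3 Lemma 1 (2)] -/
theorem exists_certificate_of_not_strictlyFeasible {A : ι → Matrix n n ℝ} {b : ι → ℝ}
    (hA : ∀ i, (A i).IsHermitian) {X₀ : Matrix n n ℝ} (h₀ : IsPrimalFeasible A b X₀)
    (hns : ∀ X, IsPrimalFeasible A b X → ¬ X.PosDef) :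
    ∃ y : ι → ℝ, IsCertificate A b y ∧ expose A y ≠ 0 := by
  classical
  -- the affine space `{X : A(X) = b}` (no symmetry or positivity imposed)
  set t : Set (Matrix n n ℝ) := {X | ∀ i, frob (A i) X = b i} with ht_def
  have ht_conv : Convex ℝ t := by
    intro X hX Y hY a c ha hc hac i
    simp only [ht_def, Set.mem_setOf_eq] at hX hY
    rw [frob_add_right, frob_smul_right, frob_smul_right, hX i, hY i, ← add_mul, hac, one_mul]
  have hdisj : Disjoint (quadPos n) t := by
    rw [Set.disjoint_left]
    intro X hXs hXt
    -- the symmetrisation of `X` would be a positive definite feasible point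
    have hYh : ((1/2 : ℝ) • (X + Xᵀ)).IsHermitian := by
      have : ((1/2 : ℝ) • (X + Xᵀ))ᵀ = (1/2 : ℝ) • (X + Xᵀ) := by
        rw [transpose_smul, transpose_add, transpose_transpose, add_comm]
      simpa [Matrix.IsHermitian] using this
    have hq : ∀ v : n → ℝ, v ⬝ᵥ (((1/2 : ℝ) • (X + Xᵀ)) *ᵥ v) = v ⬝ᵥ (X *ᵥ v) := by
      intro v
      rw [quad_smul, quad_add, quad_transpose]
      ring
    refine hns ((1/2 : ℝ) • (X + Xᵀ)) ⟨?_, fun i => ?_⟩ ?_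
    · refine PosSemidef.of_dotProduct_mulVec_nonneg hYh fun v => ?_
      rw [star_trivial, hq]
      by_cases hv : v = 0
      · simp [hv]
      · exact (hXs v hv).le
    · rw [frob_smul_right, frob_add_right, frob_transpose_right_of_isHermitian (hA i), hXt i]
      ring
    · refine PosDef.of_dotProduct_mulVec_pos hYh fun v hv => ?_
      rw [star_trivial, hq]
      exact hXs v hv
  obtain ⟨f, u, hfs, hft⟩ := geometric_hahn_banach_open convex_quadPos isOpen_quadPos ht_conv hdisj
  have hX₀t : X₀ ∈ t := h₀.2
  have hu : u ≤ f X₀ := hft X₀ hX₀t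
  have hX₀ε : ∀ ε : ℝ, 0 < ε → X₀ + ε • (1 : Matrix n n ℝ) ∈ quadPos n :=
    fun ε hε => add_smul_one_mem_quadPos h₀.1 hε
  -- `f 1 < 0`: `f X₀ + f 1 < u ≤ f X₀`
  have hf1 : f 1 < 0 := by
    have h := hfs _ (hX₀ε 1 one_pos)
    rw [one_smul, map_add] at h
    linarith
  -- `f ≤ 0` on the open cone
  have hfs0 : ∀ a ∈ quadPos n, f a ≤ 0 := by
    intro a ha
    by_contra hpos
    have hpos : 0 < f a := not_le.mp hpos
    have hua : f a < u := hfs a ha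
    have hc : 0 < u / f a := div_pos (hpos.trans hua) hpos
    have h := hfs _ (smul_mem_quadPos hc ha)
    rw [map_smul, smul_eq_mul, div_mul_cancel₀ u hpos.ne'] at h
    exact lt_irrefl _ h
  -- `0 ≤ u`: `ε f 1 < u` for all `ε > 0`
  have hf1ne : f 1 ≠ 0 := hf1.ne
  have hu0 : 0 ≤ u := by
    by_contra hneg
    have hneg : u < 0 := not_le.mp hneg
    have hε : 0 < u / (2 * f 1) := div_pos_of_neg_of_neg hneg (by linarith)
    have h := hfs _ (smul_mem_quadPos hε one_mem_quadPos)
    rw [map_smul, smul_eq_mul] at h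
    have h' : u / (2 * f 1) * f 1 = u / 2 := by
      field_simp
    linarith
  -- `f X₀ = 0`
  have hfX₀le : f X₀ ≤ 0 := by
    by_contra hpos
    have hpos : 0 < f X₀ := not_le.mp hpos
    have hε : 0 < f X₀ / (2 * (-f 1)) := div_pos hpos (by linarith)
    have h := hfs0 _ (hX₀ε _ hε)
    rw [map_add, map_smul, smul_eq_mul] at h
    have h' : f X₀ / (2 * -f 1) * f 1 = -(f X₀ / 2) := by
      field_simp
    linarith
  have hfX₀ : f X₀ = 0 := le_antisymm hfX₀le (hu0.trans hu)
  -- `f` vanishes on `Null(A) = ⋂ ker ⟨A_i, ·⟩`, hence `f = ⟨A^* c, ·⟩` for some `c`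
  have hker : (⨅ i, LinearMap.ker (frobLin (A i))) ≤ LinearMap.ker (f : Matrix n n ℝ →ₗ[ℝ] ℝ) := by
    intro H hH
    simp only [Submodule.mem_iInf, LinearMap.mem_ker, frobLin_apply] at hH
    rw [LinearMap.mem_ker, ContinuousLinearMap.coe_coe]
    by_contra hne
    have hmem : ∀ c : ℝ, X₀ + c • H ∈ t := fun c i => by
      rw [frob_add_right, frob_smul_right, hH i, mul_zero, add_zero]
      exact hX₀t i
    have h := hft _ (hmem ((u - 1 - f X₀) / f H))
    rw [map_add, map_smul, smul_eq_mul, div_mul_cancel₀ _ hne] at h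
    linarith
  obtain ⟨c, hc⟩ := (Submodule.mem_span_range_iff_exists_fun ℝ).mp (mem_span_of_iInf_ker_le_ker hker)
  have hfW : ∀ X, f X = frob (expose A c) X := by
    intro X
    have h := LinearMap.congr_fun hc X
    simp only [LinearMap.coe_sum, Finset.sum_apply, LinearMap.smul_apply, frobLin_apply, smul_eq_mul,
      ContinuousLinearMap.coe_coe] at h
    rw [frob_expose, h]
  refine ⟨-c, ⟨?_, ?_⟩, ?_⟩
  · -- `A^*(-c) = -A^* c ⪰ 0`
    rw [expose_neg]
    refine PosSemidef.of_dotProduct_mulVec_nonneg (isHermitian_expose hA c).neg fun v => ?_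
    rw [star_trivial, neg_mulVec, dotProduct_neg, ← frob_vecMulVec, ← hfW]
    -- `f (v vᵀ) ≤ 0` since `v vᵀ + ε 1` lies in the open cone for every `ε > 0`
    have hvv : (vecMulVec v v).PosSemidef := by simpa using posSemidef_vecMulVec_self_star v
    have hle : f (vecMulVec v v) ≤ 0 := by
      by_contra hpos
      have hpos : 0 < f (vecMulVec v v) := not_le.mp hpos
      have hε : 0 < f (vecMulVec v v) / (2 * (-f 1)) := div_pos hpos (by linarith)
      have h := hfs0 _ (add_smul_one_mem_quadPos hvv hε)
      rw [map_add, map_smul, smul_eq_mul] at h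
      have h' : f (vecMulVec v v) / (2 * -f 1) * f 1 = -(f (vecMulVec v v) / 2) := by
        field_simp
      linarith
    linarith
  · -- `⟨b, -c⟩ = -⟨A^* c, X₀⟩ = -f X₀ = 0`
    have h := frob_expose_of_feasible h₀ c
    rw [← hfW, hfX₀] at h
    simp only [Pi.neg_apply, neg_mul, Finset.sum_neg_distrib, ← h, neg_zero]
  · -- nontrivial: `f 1 ≠ 0`
    rw [expose_neg, neg_ne_zero]
    intro hzero
    have h1 := hfW 1
    rw [hzero] at h1
    simp [SemidefiniteComplementarity.frob] at h1
    exact hf1.ne h1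

/-- **Theorem of the alternative for the primal, `K = S^n_+`, as an equivalence** under feasibility and
symmetric data: the system is strictly feasible (has a positive definite solution) iff every facial-reduction
certificate is trivial (`A^* y ⪰ 0 ∧ ⟨b, y⟩ = 0 ⟹ A^* y = 0`) — "exactly one of the alternatives holds".
[cite: DrusvyatskiyWolkowicz2017, §3.1 Thm. (Theorem of the alternative for the primal)] [cite: BorweinWolkowicz1981, §3] -/
theorem strictlyFeasible_iff_certificates_trivial {A : ι → Matrix n n ℝ} {b : ι → ℝ}
    (hA : ∀ i, (A i).IsHermitian) {X₀ : Matrix n n ℝ} (h₀ : IsPrimalFeasible A b X₀) :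
    (∃ X, IsPrimalFeasible A b X ∧ X.PosDef) ↔ ∀ y, IsCertificate A b y → expose A y = 0 := by
  constructor
  · rintro ⟨X, hX, hXd⟩ y hy
    exact expose_eq_zero_of_posDef hy hX hXd
  · intro h
    by_contra hns
    simp only [not_exists, not_and] at hns
    obtain ⟨y, hy, hne⟩ := exists_certificate_of_not_strictlyFeasible hA h₀ hns
    exact hne (h y hy)

end Alternative

/-! ## §5. Sieve-SDP: the Basic Step as a one-coordinate facial-reduction certificate -/

section Sieve

omit [Fintype n] [DecidableEq n] in
/-- The unit multiplier `e_{i₀}` exposes `A_{i₀}` itself. [cite: ZhuPatakiTrandinh2019, §1 Basic Step (Fig. 1)] -/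
theorem expose_single [DecidableEq ι] (A : ι → Matrix n n ℝ) (i₀ : ι) :
    expose A (Pi.single i₀ 1) = A i₀ := by
  simp [expose, Pi.single_apply]

omit [Fintype n] [DecidableEq n] in
/-- **Sieve-SDP, the certificate**: a constraint with `A_{i₀} ⪰ 0` and `b_{i₀} = 0` is by itself a
facial-reduction certificate (`y = e_{i₀}`: `A^* y = A_{i₀} ⪰ 0`, `⟨b, y⟩ = b_{i₀} = 0`) — Sieve-SDP is
facial reduction restricted to such one-coordinate certificates. [cite: ZhuPatakiTrandinh2019, §1 (Basic Step; "a
simple facial reduction algorithm")] [cite: DrusvyatskiyWolkowicz2017, §3.1 Thm. (Theorem of the alternative for the primal)] -/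
theorem isCertificate_single [DecidableEq ι] {A : ι → Matrix n n ℝ} {b : ι → ℝ} {i₀ : ι}
    (hA : (A i₀).PosSemidef) (hb : b i₀ = 0) : IsCertificate A b (Pi.single i₀ 1) := by
  refine ⟨by rw [expose_single]; exact hA, ?_⟩
  simp [Pi.single_apply, hb]

/-- Hence `A_{i₀} X = 0` and `X A_{i₀} = 0` for every feasible `X` ("tr(A_i X) = 0 with A_i, X ⪰ 0 implies
A_i X = 0"). [cite: ZhuPatakiTrandinh2019, §1 Basic Step] [cite: BlekhermanParriloThomas2012, App. A Cor. A.24] -/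
theorem sieve_mul_eq_zero [DecidableEq ι] {A : ι → Matrix n n ℝ} {b : ι → ℝ} {i₀ : ι}
    (hA : (A i₀).PosSemidef) (hb : b i₀ = 0) {X : Matrix n n ℝ} (hX : IsPrimalFeasible A b X) :
    A i₀ * X = 0 ∧ X * A i₀ = 0 := by
  have h₁ := expose_mul_eq_zero (isCertificate_single hA hb) hX
  have h₂ := mul_expose_eq_zero (isCertificate_single hA hb) hX
  rw [expose_single] at h₁ h₂
  exact ⟨h₁, h₂⟩

/-- **Sieve-SDP, infeasibility exit**: a constraint with `A_{i₀} ⪰ 0` and `b_{i₀} < 0` certifies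
infeasibility of (P). [cite: ZhuPatakiTrandinh2019, §1 Basic Step ("if `b_i < 0` … (P) is infeasible")] -/
theorem sieve_infeasible [DecidableEq ι] {A : ι → Matrix n n ℝ} {b : ι → ℝ} {i₀ : ι}
    (hA : (A i₀).PosSemidef) (hb : b i₀ < 0) (X : Matrix n n ℝ) : ¬ IsPrimalFeasible A b X := by
  refine not_feasible_of_sum_neg (y := Pi.single i₀ 1) (by rw [expose_single]; exact hA) ?_ X
  simpa [Pi.single_apply] using hb

/-- Restriction of a vector to an index set `S` (zero outside). [folklore] -/
private def restrict (S : Finset n) (u : n → ℝ) : n → ℝ := fun k => if k ∈ S then u k else 0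

omit [Fintype n] [DecidableEq n] in
/-- `u|_S` vanishes off `S`. [folklore] -/
private theorem restrict_of_not_mem [DecidableEq n] {S : Finset n} (u : n → ℝ) {k : n} (hk : k ∉ S) :
    restrict S u k = 0 := by simp [restrict, hk]

omit [Fintype n] [DecidableEq n] in
/-- `u|_S = u` on `S`. [folklore] -/
private theorem restrict_of_mem [DecidableEq n] {S : Finset n} (u : n → ℝ) {k : n} (hk : k ∈ S) :
    restrict S u k = u k := by simp [restrict, hk]

/-- For `W` whose columns outside `S` vanish (`W = [D 0; 0 0]` up to permutation, `D` indexed by `S`),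
`W u = W u|_S`. [cite: ZhuPatakiTrandinh2019, §1 Basic Step (the shape `A_i = diag(D_i, 0)`)] -/
private theorem mulVec_restrict {W : Matrix n n ℝ} {S : Finset n} (hoff : ∀ j k, k ∉ S → W j k = 0)
    (u : n → ℝ) : W *ᵥ restrict S u = W *ᵥ u := by
  ext j
  simp only [mulVec, dotProduct]
  refine Finset.sum_congr rfl fun k _ => ?_
  by_cases hk : k ∈ S
  · rw [restrict_of_mem u hk]
  · rw [restrict_of_not_mem u hk, hoff j k hk, zero_mul, zero_mul]

/-- … and `uᵀ W u = (u|_S)ᵀ W (u|_S)` when moreover the rows outside `S` vanish. [folklore] -/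
private theorem quad_restrict {W : Matrix n n ℝ} {S : Finset n} (hoff : ∀ j k, k ∉ S → W j k = 0)
    (hoff' : ∀ j k, j ∉ S → W j k = 0) (u : n → ℝ) :
    restrict S u ⬝ᵥ (W *ᵥ restrict S u) = u ⬝ᵥ (W *ᵥ u) := by
  rw [mulVec_restrict hoff]
  simp only [dotProduct]
  refine Finset.sum_congr rfl fun j _ => ?_
  by_cases hj : j ∈ S
  · rw [restrict_of_mem u hj]
  · have : (W *ᵥ u) j = 0 := by
      simp only [mulVec, dotProduct]
      exact Finset.sum_eq_zero fun k _ => by rw [hoff' j k hj, zero_mul]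
    rw [this, mul_zero, mul_zero]

/-- A symmetric `W = [D 0; 0 0]` (up to permutation) with `D ≻ 0` on the index set `S` is positive
semidefinite. [cite: ZhuPatakiTrandinh2019, §1 Basic Step] -/
theorem posSemidef_of_block_posDef {W : Matrix n n ℝ} {S : Finset n} (hW : W.IsHermitian)
    (hoff : ∀ j k, k ∉ S → W j k = 0)
    (hD : ∀ u : n → ℝ, (∀ k, k ∉ S → u k = 0) → u ≠ 0 → 0 < u ⬝ᵥ (W *ᵥ u)) : W.PosSemidef := by
  have hoff' : ∀ j k, j ∉ S → W j k = 0 := fun j k hj => by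
    have h := hW.apply j k
    rw [star_trivial] at h
    rw [← h, hoff k j hj]
  refine PosSemidef.of_dotProduct_mulVec_nonneg hW fun u => ?_
  rw [star_trivial, ← quad_restrict hoff hoff' u]
  by_cases h0 : restrict S u = 0
  · rw [h0, zero_dotProduct]
  · exact (hD _ (fun k hk => restrict_of_not_mem u hk) h0).le

/-- The kernel of such a `W` consists of vectors vanishing on `S` (`ker [D 0; 0 0] = 0 ⊕ ℝ^{Sᶜ}`).
[cite: ZhuPatakiTrandinh2019, §1 Basic Step] -/
theorem apply_eq_zero_of_mulVec_eq_zero {W : Matrix n n ℝ} {S : Finset n}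
    (hoff : ∀ j k, k ∉ S → W j k = 0)
    (hD : ∀ u : n → ℝ, (∀ k, k ∉ S → u k = 0) → u ≠ 0 → 0 < u ⬝ᵥ (W *ᵥ u))
    {u : n → ℝ} (hu : W *ᵥ u = 0) {j : n} (hj : j ∈ S) : u j = 0 := by
  have hw : W *ᵥ restrict S u = 0 := by rw [mulVec_restrict hoff, hu]
  by_cases h0 : restrict S u = 0
  · have := congrFun h0 j
    rwa [restrict_of_mem u hj] at this
  · have h := hD _ (fun k hk => restrict_of_not_mem u hk) h0
    rw [hw, dotProduct_zero] at h
    exact absurd h (lt_irrefl 0)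

/-- **Sieve-SDP, Basic Step (row/column deletion)**: if some constraint reads `⟨A_{i₀}, X⟩ = 0` with
`A_{i₀} = [D 0; 0 0]` (up to a permutation), `D ≻ 0` indexed by `S`, then every feasible `X` has its rows
and columns indexed by `S` equal to zero — so they may be deleted, which is the reduced problem of §3 for
the face exposed by the certificate `e_{i₀}`. [cite: ZhuPatakiTrandinh2019, §1 Basic Step (Fig. 1), Steps 1–2]
[cite: DrusvyatskiyWolkowicz2017, §4.3] -/
theorem sieve_basic_step [DecidableEq ι] {A : ι → Matrix n n ℝ} {b : ι → ℝ} {i₀ : ι} {S : Finset n}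
    (hH : (A i₀).IsHermitian) (hoff : ∀ j k, k ∉ S → A i₀ j k = 0)
    (hD : ∀ u : n → ℝ, (∀ k, k ∉ S → u k = 0) → u ≠ 0 → 0 < u ⬝ᵥ (A i₀ *ᵥ u))
    (hb : b i₀ = 0) {X : Matrix n n ℝ} (hX : IsPrimalFeasible A b X) {j : n} (hj : j ∈ S) (l : n) :
    X j l = 0 ∧ X l j = 0 := by
  have hAX := (sieve_mul_eq_zero (posSemidef_of_block_posDef hH hoff hD) hb hX).1
  -- column `l` of `X` lies in `ker A_{i₀}`
  have hcol : A i₀ *ᵥ (fun k => X k l) = 0 := by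
    ext j'
    have := congrFun (congrFun hAX j') l
    simpa [mul_apply, mulVec, dotProduct] using this
  have h1 : X j l = 0 := apply_eq_zero_of_mulVec_eq_zero hoff hD hcol hj
  refine ⟨h1, ?_⟩
  have hsym := hX.1.isHermitian.apply j l
  rw [star_trivial] at hsym
  exact hsym.trans h1

end Sieve

/-! ## §6. Worked example: the motivating instance (1.1) of Sieve-SDP -/

section Example

/-- The constraint matrices of [ZhuPatakiTrandinh2019, §1 (1.1)]: `A₀ = e₁e₁ᵀ`, `A₁` the anti-diagonal
`[0 0 1; 0 1 0; 1 0 0]`. [cite: ZhuPatakiTrandinh2019, §1 example (1.1)] -/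
def sieveExA : Fin 2 → Matrix (Fin 3) (Fin 3) ℝ :=
  ![!![1, 0, 0; 0, 0, 0; 0, 0, 0], !![0, 0, 1; 0, 1, 0; 1, 0, 0]]

/-- The right-hand side `b = (0, -1)` of [ZhuPatakiTrandinh2019, §1 (1.1)]. [cite: ZhuPatakiTrandinh2019, §1 example (1.1)] -/
def sieveExb : Fin 2 → ℝ := ![0, -1]

/-- **Example (1.1) of Sieve-SDP is infeasible**, by the argument of the text run through `sieve_basic_step`:
the first constraint (`A₀ = [1 0; 0 0] ⊕ 0 ≻ 0` on `S = {0}`, `b₀ = 0`) forces the first row and column of a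
feasible `X` to vanish, and then the second constraint reads `x₂₂ = -1`, contradicting `X ⪰ 0` ("then
`x₁₁ = 0`, hence the first row and column of `X` are zero by positive semidefiniteness, so the second constraint
implies `x₂₂ = -1`, which is a contradiction"). [cite: ZhuPatakiTrandinh2019, §1 example (1.1) and Example 1] -/
theorem sieveEx_infeasible (X : Matrix (Fin 3) (Fin 3) ℝ) : ¬ IsPrimalFeasible sieveExA sieveExb X := by
  intro hX
  have hH : (sieveExA 0).IsHermitian := by
    have : (sieveExA 0)ᵀ = sieveExA 0 := by
      ext j k; fin_cases j <;> fin_cases k <;> simp [sieveExA]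
    simpa [Matrix.IsHermitian] using this
  have hoff : ∀ j k : Fin 3, k ∉ ({0} : Finset (Fin 3)) → sieveExA 0 j k = 0 := by
    intro j k hk
    rw [Finset.mem_singleton] at hk
    fin_cases j <;> fin_cases k <;> simp_all [sieveExA]
  have hD : ∀ u : Fin 3 → ℝ, (∀ k, k ∉ ({0} : Finset (Fin 3)) → u k = 0) → u ≠ 0 →
      0 < u ⬝ᵥ (sieveExA 0 *ᵥ u) := by
    intro u hu hne
    have h1 : u 1 = 0 := hu 1 (by decide)
    have h2 : u 2 = 0 := hu 2 (by decide)
    have h0 : u 0 ≠ 0 := by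
      intro h0
      apply hne
      ext k
      fin_cases k
      · exact h0
      · exact h1
      · exact h2
    have hq : u ⬝ᵥ (sieveExA 0 *ᵥ u) = u 0 * u 0 := by
      simp [sieveExA, Matrix.mulVec, dotProduct, Fin.sum_univ_three, h1, h2]
    rw [hq]
    exact mul_self_pos.mpr h0
  have hz : ∀ l : Fin 3, X 0 l = 0 ∧ X l 0 = 0 := fun l =>
    sieve_basic_step (i₀ := (0 : Fin 2)) (S := ({0} : Finset (Fin 3))) hH hoff hD (by simp [sieveExb]) hX
      (Finset.mem_singleton_self 0) l
  have h2 : frob (sieveExA 1) X = sieveExb 1 := hX.2 1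
  have e : frob (sieveExA 1) X = X 2 0 + X 1 1 + X 0 2 := by
    simp [SemidefiniteComplementarity.frob, Matrix.trace, sieveExA, Matrix.vecMul, dotProduct,
      Fin.sum_univ_three]
  rw [e, (hz 2).2, (hz 2).1] at h2
  have hx : X 1 1 = -1 := by simpa [sieveExb] using h2
  have hnn : 0 ≤ X 1 1 := hX.1.diag_nonneg
  linarith

end Example

end Literature.Computation.Certificates.FacialReduction

end
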